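import Summits.AtomisticToContinuum.HydrodynamicLimit.Theses.ImplosionDichotomy
import Summits.AtomisticToContinuum.HydrodynamicLimit.Theorems.DenseExcursion.Negative.AtTimeZero

/-!
# No polynomial compression AT TIME ZERO: admissible data are pinned and σ-uniformly bounded

Negative knowledge for the crux `ImplosionDichotomy.PolynomialCompression` (stmt-AtomisticToContinuum-12587), from
the standing disprover's `Cruxes/PolynomialCompression/Disproof.lean` §7 (refuted strengthening, pattern (c)).
`PolynomialCompressionAtTimeZero` is the crux with its conclusion `∃ t ∈ [0,T), ∃ x, σ^(-κ) ≤ ρ_t(x)` specialised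
to `t = 0` (`0 < T ∧ ∃ x, σ^(-κ) ≤ ρ_0(x)`) — the cheapest conceivable witness, blow-up already in the data — and it
is FALSE, unconditionally: the `t = 0` tie PINS the initial density of every admissible classical solution to the
explicit cluster-expansion density `rhoLim (profileOf a₀) σ` of the tree's law of large numbers
(`DenseExcursionAtTimeZero.density_zero_eq_rhoLim`, imported from the sibling crux's negative file: uniqueness of
limits in probability + the PROVED `localGibbs_densityLLN` + laws of mass one for `σ ≤ 1/2` + a flow family by
Alexander), and `rhoLim < (2e+1)·M` uniformly in `σ` (`M = sup a₀/∫a₀`, `DenseExcursionAtTimeZero.rhoLim_lt`), while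
`σ^(-κ) → ∞`. So EVERY witness of the crux needs genuine DYNAMICAL compression by the diverging factor `σ^(-κ)` of
one fixed profile triple. refuter-cdisprove-stmt-AtomisticToContinuum-12587-g3-0.
-/

noncomputable section

namespace Summit.AtomisticToContinuum.HydrodynamicLimit.Theorems

open MeasureTheory Filter Set Topology
open Literature.MathematicalPhysics.KineticTheory Literature.Analysis.FluidPDE
open Literature.Analysis.FunctionSpaces

/-- The crux `PolynomialCompression` with the compression reached AT TIME `0` (all else verbatim). -/
def PolynomialCompressionAtTimeZero : Prop :=
  ∃ κ : ℝ, 0 < κ ∧ ∃ (a₀ θ₀ : Literature.MathematicalPhysics.KineticTheory.T3 → ℝ) (u₀ : Literature.MathematicalPhysics.KineticTheory.T3 → Literature.MathematicalPhysics.KineticTheory.V3), Continuous a₀ ∧ Continuous θ₀ ∧ Continuous u₀ ∧ (∀ x, 0 < a₀ x) ∧ (∀ x, 0 < θ₀ x) ∧ ∀ σ₀ : ℝ, 0 < σ₀ → ∃ σ : ℝ, 0 < σ ∧ σ < σ₀ ∧ ∃ (T : ℝ) (ρ θ : ℝ → Literature.MathematicalPhysics.KineticTheory.T3 → ℝ)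 (u : ℝ → Literature.MathematicalPhysics.KineticTheory.T3 → Literature.MathematicalPhysics.KineticTheory.V3), Literature.MathematicalPhysics.KineticTheory.IsHardSphereEulerSolution σ T ρ u θ ∧ (∀ Φ : (N : ℕ) → Literature.Analysis.FluidPDE.HardSphereFlow (Literature.Analysis.FluidPDE.Torus.geometry (Fin 3)) (Literature.MathematicalPhysics.KineticTheory.hsDiameter σ N) (N + 1), Literature.MathematicalPhysics.KineticTheory.TendstoHydroFieldsAt (fun N => Literature.MathematicalPhysics.KineticTheory.localGibbsLaw σ a₀ u₀ θ₀ N (Φ N)) Φ ρ u θ 0) ∧ 0 < T ∧ ∃ x, σ ^ (-κ) ≤ ρ 0 x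

open DenseExcursionAtTimeZero in
/-- NO COMPRESSION AT `t = 0`: below the statics threshold the initial density of every admissible classical
solution is `ρ_0 = rhoLim (profileOf a₀) σ < K := (2e+1)M` uniformly in `σ`, while `σ^(-κ) ≥ K` as soon as
`σ ≤ K^(-1/κ)` (take `σ < min(σ₁, K^(-1/κ))` in the witness). [folklore] -/
theorem polynomialCompression_false_atTimeZero : ¬ PolynomialCompressionAtTimeZero := by
  rintro ⟨κ, hκ, a₀, θ₀, u₀, ha, hθ, hu, ha0, hθ0, H⟩
  obtain ⟨σ₁, hσ₁, hσ₁2, G⟩ := density_zero_eq_rhoLim ha hθ hu ha0 hθ0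
  set P := profileOf a₀ ha ha0 with hP
  set K := (2 * Real.exp 1 + 1) * P.M with hK
  have hK0 : 0 < K := by have := P.M_pos; positivity
  obtain ⟨σ, hσ, hσlt, T, ρ, θ, u, hE, hA, hT, x, hx⟩ :=
    H (min σ₁ (K ^ (-κ⁻¹))) (lt_min hσ₁ (Real.rpow_pos_of_pos hK0 _))
  have hσ1 : σ < σ₁ := lt_of_lt_of_le hσlt (min_le_left _ _)
  have hσK : σ < K ^ (-κ⁻¹) := lt_of_lt_of_le hσlt (min_le_right _ _)
  have hσ2 : σ < 1 / 2 := hσ1.trans_le hσ₁2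
  obtain ⟨hS, G'⟩ := G σ hσ hσ1
  obtain ⟨Φ⟩ : Nonempty ((N : ℕ) → HardSphereFlow (Torus.geometry (Fin 3)) (hsDiameter σ N) (N + 1)) :=
    ⟨fun N => Classical.choice (HardSphereFlow.nonempty_torus_holds (d := Fin 3)
      (hsDiameter_pos hσ N) ((hsDiameter_le hσ.le N).trans_lt (hσ2.trans_eq (by norm_num))) (N + 1))⟩
  have h0 : (0 : ℝ) ∈ Ico 0 T := ⟨le_rfl, hT⟩
  have hρ0 : ρ 0 = rhoLim P σ :=
    G' ρ θ u Φ (hE.smooth_density.isSmooth_slice h0).continuous (hA Φ)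
  have hlt : ρ 0 x < K := by rw [hρ0]; exact rhoLim_lt hS x
  have hge : K ≤ σ ^ (-κ) := by
    have h1 := Real.rpow_le_rpow_of_nonpos hσ hσK.le (by linarith : -κ ≤ 0)
    rwa [← Real.rpow_mul hK0.le, neg_mul_neg, inv_mul_cancel₀ hκ.ne', Real.rpow_one] at h1
  linarith

end Summit.AtomisticToContinuum.HydrodynamicLimit.Theorems

end
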